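import Literature.NumberTheory.Sieve.SmoothMajorantCRT
import HarnessLib

/-!
# Local input for the smooth linear forms estimate (Conlon–Fox–Zhao §9): the divisibility weights

Trunk T-SIEVE. D. Conlon, J. Fox, Y. Zhao, *The Green–Tao theorem: an exposition*
(arXiv:1403.2957), §9, p. 17: the weight `E_{x ∈ ℤ_D^t}[1_{d_j, d'_j ∣ θ_j(x) ∀ j}]`
(`D = lcm(d_1, d'_1, …, d_m, d'_m)`, square-free `d_j, d'_j`) and its factorisation over the
primes `p ∣ D` by the Chinese remainder theorem ("Splitting `d_1, d'_1, …` into prime factors"),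
the local factors being the densities `ω_p(X_p ∪ X'_p)` of `SmoothMajorantCRT`
(`X_p = {j : p ∣ d_j}`, `X'_p = {j : p ∣ d'_j}`).

* `localDensity₀` (the density `ω_p` as a function of a natural number `p`, `= 1` at `p = 0`);
* `tuplePrimes`, `tuplePeriod` (`D`), `tupleDensity` (the weight, as the average over the period
  box `[0, D)^t`);
* `tupleDensity_eq_prod_localDensity` (PROVED): for square-free tuples with prime factors in a
  finite set of primes `P`, `tupleDensity = ∏_{p ∈ P} ω_p(X_p ∪ X'_p)`.

## References
* D. Conlon, J. Fox, Y. Zhao, EMS Surv. Math. Sci. 1 (2014), 249–282, §9 (p. 17).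
  [cite: ConlonFoxZhao2014]
* B. Green, T. Tao, Ann. of Math. 167 (2008), (10.2)–(10.3) and Lemma 10.1 (the same step).
  [cite: GreenTaoAnnals2008]
-/

noncomputable section

open Finset
open scoped BigOperators

namespace Literature.NumberTheory.Sieve.CFZ

variable {m t : ℕ}

/-! ### The local density as a function of a natural number -/

/-- `ω_p(X)` for a natural number `p` (the density `localDensity` for `p ≠ 0`; `1` at `p = 0`).
[cite: ConlonFoxZhao2014, Section 9] -/
def localDensity₀ (p W : ℕ) (L : Fin m → Fin t → ℤ) (b : Fin m → ℤ) (X : Finset (Fin m)) : ℝ :=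
  if h : p = 0 then 1 else (haveI : NeZero p := ⟨h⟩; localDensity p W L b X)

/-- `localDensity₀ = localDensity` for `p ≠ 0`. [cite: ConlonFoxZhao2014, Section 9] -/
theorem localDensity₀_eq (p W : ℕ) [NeZero p] (L : Fin m → Fin t → ℤ) (b : Fin m → ℤ)
    (X : Finset (Fin m)) : localDensity₀ p W L b X = localDensity p W L b X := by
  unfold localDensity₀
  rw [dif_neg (NeZero.ne p)]

/-- `ω_p(∅) = 1`. [cite: ConlonFoxZhao2014, Section 9] -/
@[simp] theorem localDensity₀_empty (p W : ℕ) (L : Fin m → Fin t → ℤ) (b : Fin m → ℤ) :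
    localDensity₀ p W L b ∅ = 1 := by
  unfold localDensity₀
  split_ifs with h
  · rfl
  · haveI : NeZero p := ⟨h⟩
    exact localDensity_empty L b

/-- `0 ≤ ω_p(X) ≤ 1`. [cite: ConlonFoxZhao2014, Section 9] -/
theorem localDensity₀_nonneg_le_one (p W : ℕ) (L : Fin m → Fin t → ℤ) (b : Fin m → ℤ)
    (X : Finset (Fin m)) : 0 ≤ localDensity₀ p W L b X ∧ localDensity₀ p W L b X ≤ 1 := by
  unfold localDensity₀
  split_ifs with h
  · norm_num
  · haveI : NeZero p := ⟨h⟩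
    exact localDensity_nonneg_le_one L b X

/-! ### The weight of a pair of tuples -/

/-- The primes dividing some entry of the pair of tuples `(d, d')`.
[cite: ConlonFoxZhao2014, Section 9] -/
def tuplePrimes (d d' : Fin m → ℕ) : Finset ℕ :=
  univ.biUnion fun j => (d j).primeFactors ∪ (d' j).primeFactors

/-- The period `D = ∏_{p ∈ tuplePrimes} p` (the lcm of the entries, for square-free tuples).
[cite: ConlonFoxZhao2014, Section 9] -/
def tuplePeriod (d d' : Fin m → ℕ) : ℕ := ∏ p ∈ tuplePrimes d d', p

/-- **The weight** `E_{x ∈ ℤ_D^t}[1_{d_j, d'_j ∣ θ_j(x) ∀ j}]`, written as the average over the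
period box `[0, D)^t` of integer points (`θ_j = W(∑_i L_{ji} x_i + b_j) + 1 = wForm`).
[cite: ConlonFoxZhao2014, Section 9] -/
def tupleDensity (W : ℕ) (L : Fin m → Fin t → ℤ) (b : Fin m → ℤ) (d d' : Fin m → ℕ) : ℝ :=
  𝔼 x ∈ Fintype.piFinset (fun _ : Fin t => Ico (0 : ℤ) (tuplePeriod d d')),
    if ∀ j, ((d j : ℤ) ∣ wForm W (L j) (b j) x) ∧ ((d' j : ℤ) ∣ wForm W (L j) (b j) x) then (1 : ℝ)
    else 0

/-- The elements of `tuplePrimes` are primes. [cite: ConlonFoxZhao2014, Section 9] -/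
theorem prime_of_mem_tuplePrimes {d d' : Fin m → ℕ} {p : ℕ} (hp : p ∈ tuplePrimes d d') : p.Prime := by
  simp only [tuplePrimes, mem_biUnion, mem_univ, true_and, mem_union] at hp
  obtain ⟨j, h | h⟩ := hp <;> exact Nat.prime_of_mem_primeFactors h

/-- The period `D` is square-free. [cite: ConlonFoxZhao2014, Section 9] -/
theorem squarefree_tuplePeriod (d d' : Fin m → ℕ) : Squarefree (tuplePeriod d d') :=
  squarefree_prod_of_primes fun _ hp => prime_of_mem_tuplePrimes hp

/-- The prime factors of `D` are `tuplePrimes`. [cite: ConlonFoxZhao2014, Section 9] -/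
theorem primeFactors_tuplePeriod (d d' : Fin m → ℕ) : (tuplePeriod d d').primeFactors = tuplePrimes d d' :=
  Nat.primeFactors_prod fun _ hp => prime_of_mem_tuplePrimes hp

/-- `D ≠ 0`. [cite: ConlonFoxZhao2014, Section 9] -/
theorem tuplePeriod_ne_zero (d d' : Fin m → ℕ) : tuplePeriod d d' ≠ 0 :=
  (squarefree_tuplePeriod d d').ne_zero

/-- `primeFactors(d_j) ⊆ tuplePrimes`. [cite: ConlonFoxZhao2014, Section 9] -/
theorem primeFactors_subset_tuplePrimes_left (d d' : Fin m → ℕ) (j : Fin m) :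
    (d j).primeFactors ⊆ tuplePrimes d d' := fun p hp => by
  simp only [tuplePrimes, mem_biUnion, mem_univ, true_and, mem_union]
  exact ⟨j, Or.inl hp⟩

/-- `primeFactors(d'_j) ⊆ tuplePrimes`. [cite: ConlonFoxZhao2014, Section 9] -/
theorem primeFactors_subset_tuplePrimes_right (d d' : Fin m → ℕ) (j : Fin m) :
    (d' j).primeFactors ⊆ tuplePrimes d d' := fun p hp => by
  simp only [tuplePrimes, mem_biUnion, mem_univ, true_and, mem_union]
  exact ⟨j, Or.inr hp⟩

/-- For tuples of square-free numbers with prime factors in `P`, `tuplePrimes ⊆ P`.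
[cite: ConlonFoxZhao2014, Section 9] -/
theorem tuplePrimes_subset {P : Finset ℕ} (hP : ∀ p ∈ P, p.Prime) {d d' : Fin m → ℕ}
    (hd : ∀ j, d j ∈ squarefreeOf P) (hd' : ∀ j, d' j ∈ squarefreeOf P) : tuplePrimes d d' ⊆ P := by
  intro p hp
  simp only [tuplePrimes, mem_biUnion, mem_univ, true_and, mem_union] at hp
  obtain ⟨j, h | h⟩ := hp
  · exact (((mem_squarefreeOf hP).1 (hd j)).2) h
  · exact (((mem_squarefreeOf hP).1 (hd' j)).2) h

/-! ### Divisibility by a square-free number, prime by prime -/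

/-- For square-free `e`: `e ∣ n ↔ p ∣ n` for every prime `p ∣ e`. [folklore] -/
theorem squarefree_dvd_iff {e : ℕ} (he : Squarefree e) (n : ℤ) :
    (e : ℤ) ∣ n ↔ ∀ p ∈ e.primeFactors, (p : ℤ) ∣ n := by
  constructor
  · intro h p hp
    exact (Int.natCast_dvd_natCast.2 (Nat.dvd_of_mem_primeFactors hp)).trans h
  · intro h
    rw [Int.natCast_dvd]
    rw [← Nat.prod_primeFactors_of_squarefree he]
    refine Finset.prod_primes_dvd _ (fun p hp => Nat.prime_iff.1 (Nat.prime_of_mem_primeFactors hp))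
      fun p hp => ?_
    have := h p hp
    rwa [Int.natCast_dvd] at this

/-- `p ∣ n ↔ (n : ℤ_p) = 0`, through any ring homomorphism `ℤ_D → ℤ_p` applied to `(n : ℤ_D)`.
[folklore] -/
theorem intCast_dvd_iff_map_eq_zero {D p : ℕ} (f : ZMod D →+* ZMod p) (n : ℤ) :
    (p : ℤ) ∣ n ↔ f (n : ZMod D) = 0 := by
  rw [map_intCast, ZMod.intCast_zmod_eq_zero_iff_dvd]

/-! ### The Chinese remainder factorisation of the weight -/

/-- The divisibility indicator as a product of local indicators through the Chinese remainder map: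
for `x ∈ ℤ^t` and `D` the period,
`1[∀ j, d_j ∣ θ_j(x) ∧ d'_j ∣ θ_j(x)] = ∏_{p ∣ D} 1[∀ j ∈ X_p ∪ X'_p, θ_j(x mod p) = 0]`.
[cite: ConlonFoxZhao2014, Section 9] -/
theorem indicator_eq_prod_crt (W : ℕ) (L : Fin m → Fin t → ℤ) (b : Fin m → ℤ) {d d' : Fin m → ℕ}
    (hd : ∀ j, Squarefree (d j)) (hd' : ∀ j, Squarefree (d' j)) (x : Fin t → ℤ) :
    (if ∀ j, ((d j : ℤ) ∣ wForm W (L j) (b j) x) ∧ ((d' j : ℤ) ∣ wForm W (L j) (b j) x) then (1 : ℝ)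
      else 0) =
      ∏ p : (tuplePeriod d d').primeFactors,
        (if ∀ j ∈ pattern d p ∪ pattern d' p,
            wForm W (L j) (b j) (fun i => crtSquarefree (squarefree_tuplePeriod d d')
              ((x i : ℤ) : ZMod (tuplePeriod d d')) p) = 0
          then (1 : ℝ) else 0) := by
  classical
  set D := tuplePeriod d d' with hD_def
  have hD := squarefree_tuplePeriod d d'
  -- the `p`-component of the Chinese remainder map is a ring homomorphism `ℤ_D → ℤ_p`
  set π : ∀ p : D.primeFactors, ZMod D →+* ZMod (p : ℕ) := fun p =>
    (Pi.evalRingHom (fun q : D.primeFactors => ZMod (q : ℕ)) p).comp (crtSquarefree hD).toRingHom with hπ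
  have hπx : ∀ (p : D.primeFactors) (j : Fin m),
      wForm W (L j) (b j) (fun i => crtSquarefree hD ((x i : ℤ) : ZMod D) p) =
        π p ((wForm W (L j) (b j) x : ℤ) : ZMod D) := by
    intro p j
    have hl : (fun i => crtSquarefree hD ((x i : ℤ) : ZMod D) p) = fun i => ((x i : ℤ) : ZMod (p : ℕ)) :=
      funext fun i => (map_intCast (π p) (x i) : _)
    rw [hl, map_intCast, show ((wForm W (L j) (b j) x : ℤ) : ZMod (p : ℕ)) =
      Int.castRingHom (ZMod (p : ℕ)) (wForm W (L j) (b j) x) from rfl, map_wForm]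
    rfl
  rw [prod_boole]
  congr 1
  apply propext
  constructor
  · -- `d_j ∣ θ_j ⇒ p ∣ θ_j` for `p ∣ d_j`
    rintro h p - j hj
    rw [hπx, ← intCast_dvd_iff_map_eq_zero (π p)]
    have hpP : (p : ℕ).Prime := Nat.prime_of_mem_primeFactors p.2
    rcases mem_union.1 hj with hj | hj
    · have hpd : (p : ℕ) ∣ d j := by simpa [pattern] using hj
      exact (Int.natCast_dvd_natCast.2 hpd).trans (h j).1
    · have hpd : (p : ℕ) ∣ d' j := by simpa [pattern] using hj
      exact (Int.natCast_dvd_natCast.2 hpd).trans (h j).2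
  · intro h j
    constructor
    · rw [squarefree_dvd_iff (hd j)]
      intro p hp
      have hpD : p ∈ D.primeFactors := by
        rw [hD_def, primeFactors_tuplePeriod]; exact primeFactors_subset_tuplePrimes_left d d' j hp
      have := h ⟨p, hpD⟩ (mem_univ _) j (by
        rw [mem_union]; left
        simpa [pattern] using Nat.dvd_of_mem_primeFactors hp)
      rwa [hπx, ← intCast_dvd_iff_map_eq_zero (π ⟨p, hpD⟩)] at this
    · rw [squarefree_dvd_iff (hd' j)]
      intro p hp
      have hpD : p ∈ D.primeFactors := by
        rw [hD_def, primeFactors_tuplePeriod]; exact primeFactors_subset_tuplePrimes_right d d' j hp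
      have := h ⟨p, hpD⟩ (mem_univ _) j (by
        rw [mem_union]; right
        simpa [pattern] using Nat.dvd_of_mem_primeFactors hp)
      rwa [hπx, ← intCast_dvd_iff_map_eq_zero (π ⟨p, hpD⟩)] at this

/-- The local average of the local indicator is the local density:
`E_{u ∈ ℤ_p^t} 1[∀ j ∈ X, θ_j(u) = 0] = ω_p(X)`. [cite: ConlonFoxZhao2014, Section 9] -/
theorem expect_indicator_eq_localDensity (p W : ℕ) [NeZero p] (L : Fin m → Fin t → ℤ) (b : Fin m → ℤ)
    (X : Finset (Fin m)) :
    𝔼 u : Fin t → ZMod p, (if ∀ j ∈ X, wForm W (L j) (b j) u = 0 then (1 : ℝ) else 0) =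
      localDensity p W L b X := by
  classical
  rw [expect_eq_sum_div_card, sum_boole, card_univ, Fintype.card_pi, Finset.prod_const, ZMod.card,
    card_univ, Fintype.card_fin]
  unfold localDensity
  push_cast
  rfl

/-- **Chinese remainder factorisation of the weight** (CFZ p. 17; Green–Tao (10.2)–(10.3)): for
square-free tuples with prime factors in a finite set of primes `P`,
`E_{x ∈ ℤ_D^t}[1_{d_j, d'_j ∣ θ_j(x) ∀ j}] = ∏_{p ∈ P} ω_p(X_p ∪ X'_p)` (`ω_p(∅) = 1` for the primes
not dividing `D`). [cite: ConlonFoxZhao2014, Section 9] -/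
theorem tupleDensity_eq_prod_localDensity (W : ℕ) (L : Fin m → Fin t → ℤ) (b : Fin m → ℤ)
    {P : Finset ℕ} (hP : ∀ p ∈ P, p.Prime) {d d' : Fin m → ℕ}
    (hd : ∀ j, d j ∈ squarefreeOf P) (hd' : ∀ j, d' j ∈ squarefreeOf P) :
    tupleDensity W L b d d' = ∏ p ∈ P, localDensity₀ p W L b (pattern d p ∪ pattern d' p) := by
  classical
  set D := tuplePeriod d d' with hD_def
  have hD := squarefree_tuplePeriod d d'
  haveI : NeZero D := ⟨hD.ne_zero⟩
  have hsq : ∀ j, Squarefree (d j) := fun j => ((mem_squarefreeOf hP).1 (hd j)).1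
  have hsq' : ∀ j, Squarefree (d' j) := fun j => ((mem_squarefreeOf hP).1 (hd' j)).1
  -- Step 1: the period-box average is the `ℤ_D^t` average of the CRT product
  set G : (Fin t → ZMod D) → ℝ := fun y => ∏ p : D.primeFactors,
    (if ∀ j ∈ pattern d p ∪ pattern d' p,
        wForm W (L j) (b j) (fun i => crtSquarefree hD (y i) p) = 0 then (1 : ℝ) else 0) with hG
  have h1 : tupleDensity W L b d d' = 𝔼 y : Fin t → ZMod D, G y := by
    unfold tupleDensity
    rw [← hD_def]
    have hbox : (Fintype.piFinset fun _ : Fin t => Ico (0 : ℤ) D) =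
        Fintype.piFinset fun j : Fin t => Ico ((fun _ => (0 : ℤ)) j) ((fun _ => (0 : ℤ)) j + D * (fun _ => 1) j) := by
      simp
    rw [hbox, ← expect_box_comp_intCast_eq (fun _ => (0 : ℤ)) (fun _ => 1) (fun _ => le_rfl) G]
    refine expect_congr rfl fun x _ => ?_
    rw [indicator_eq_prod_crt W L b hsq hsq' x]
  -- Step 2: independence of the local coordinates
  have h2 : 𝔼 y : Fin t → ZMod D, G y = ∏ p : D.primeFactors,
      𝔼 u : Fin t → ZMod (p : ℕ), (if ∀ j ∈ pattern d p ∪ pattern d' p, wForm W (L j) (b j) u = 0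
        then (1 : ℝ) else 0) := by
    have := expect_prod_crt hD (t := t) fun p u =>
      (if ∀ j ∈ pattern d p ∪ pattern d' p, wForm W (L j) (b j) u = 0 then (1 : ℝ) else 0)
    simpa [hG] using this
  -- Step 3: local averages are local densities; primes of `P` not dividing `D` contribute `1`
  rw [h1, h2]
  have h3 : ∀ p : D.primeFactors,
      𝔼 u : Fin t → ZMod (p : ℕ), (if ∀ j ∈ pattern d p ∪ pattern d' p, wForm W (L j) (b j) u = 0
        then (1 : ℝ) else 0) = localDensity₀ p W L b (pattern d p ∪ pattern d' p) := by
    intro p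
    rw [expect_indicator_eq_localDensity, localDensity₀_eq]
  rw [Fintype.prod_congr _ _ h3]
  rw [← prod_coe_sort P]
  -- compare the two products over subtypes via products over `Finset ℕ`
  have hsub : D.primeFactors ⊆ P := by
    rw [hD_def, primeFactors_tuplePeriod]; exact tuplePrimes_subset hP hd hd'
  rw [prod_coe_sort P (f := fun p => localDensity₀ p W L b (pattern d p ∪ pattern d' p)),
    prod_coe_sort D.primeFactors (f := fun p => localDensity₀ p W L b (pattern d p ∪ pattern d' p)),
    ← prod_subset hsub]
  intro p hpP hpD
  have hpat : pattern d p ∪ pattern d' p = ∅ := by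
    ext j
    simp only [mem_union, notMem_empty, iff_false, not_or]
    have hp := hP p hpP
    constructor
    · intro hj
      have hpd : p ∣ d j := by simpa [pattern] using hj
      refine hpD ?_
      rw [hD_def, primeFactors_tuplePeriod]
      exact primeFactors_subset_tuplePrimes_left d d' j
        (Nat.mem_primeFactors.2 ⟨hp, hpd, (hsq j).ne_zero⟩)
    · intro hj
      have hpd : p ∣ d' j := by simpa [pattern] using hj
      refine hpD ?_
      rw [hD_def, primeFactors_tuplePeriod]
      exact primeFactors_subset_tuplePrimes_right d d' j
        (Nat.mem_primeFactors.2 ⟨hp, hpd, (hsq' j).ne_zero⟩)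
  rw [hpat, localDensity₀_empty]

end Literature.NumberTheory.Sieve.CFZ
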